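import Summits.AtomisticToContinuum.HydrodynamicLimit.Theses.ImplosionDichotomy
import Summits.AtomisticToContinuum.HydrodynamicLimit.Theses.LaxScheme
import Literature.MathematicalPhysics.KineticTheory.HardSphereEulerLLN
import Literature.MathematicalPhysics.KineticTheory.HardSphereEulerProofs
import Literature.Analysis.FluidPDE.CollisionalTransferTimeDep
import Summits.AtomisticToContinuum.HydrodynamicLimit.Theorems.ImplosionDichotomyHydroLimitInBandEntropyDock
import Summits.AtomisticToContinuum.HydrodynamicLimit.Theorems.ImplosionDichotomyHydroLimitInBandCoreReduction
import Summits.AtomisticToContinuum.HydrodynamicLimit.Theorems.TwoClocksClampedWindowDockActivityInversion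
import Summits.AtomisticToContinuum.HydrodynamicLimit.Theorems.CollisionIsometryCLTMacroClosureStubLedgerScaling
import Summits.AtomisticToContinuum.HydrodynamicLimit.Theorems.ImplosionDichotomyHydroLimitInBandWindowBalance
import Summits.AtomisticToContinuum.HydrodynamicLimit.Theorems.ImplosionDichotomyHydroLimitInBandEulerPrimitive
import Summits.AtomisticToContinuum.HydrodynamicLimit.Theorems.ImplosionDichotomyPolynomialCompressionEosRatioAnalytic
import Summits.AtomisticToContinuum.HydrodynamicLimit.Theorems.TwoClocksClampedWindowDockTimeZero
import Summits.AtomisticToContinuum.HydrodynamicLimit.Theorems.TwoClocksClampedEntropyClockTimeZeroReference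

/-!
# Line `mean-current-balance` — checked skeleton for the crux `HydroLimitInBand`
(stmt-AtomisticToContinuum-9133; route ImplosionDichotomy, decl
`Summit.AtomisticToContinuum.HydrodynamicLimit.Theses.ImplosionDichotomy.HydroLimitInBand`)

Crux-strategist `planner-cstrat-stmt-AtomisticToContinuum-9133-0`, 2026-08-16 (runs ALONGSIDE the lead's line
`IdeatorOneSketch`; nothing of the lead's skeleton is touched; only LANDED Theorems are imported).

## The line in one sentence

THE ENTROPY CLOCK IN CONTINUOUS MACROSCOPIC TIME, CLOSED BY MEAN ONE-BLOCKS. Along the explicit Euler-driven reference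
family `ψ_s = localGibbsLaw σ (ρ_s · Rf(σ³ρ_s)) u_s θ_s` (the same reference the lead's glue uses), the relative entropy
`H_N(s) = KL(f_s ‖ ψ_s)` of the deterministically evolved local Gibbs law satisfies an EXACT finite-`N` balance law with a
SMOOTHLY TIME-DEPENDENT reference (stub B1 — the lead's landed R1 has the reference frozen per window; here the landed
time-dependent trajectory balance `IsHardSphereTrajectory.sub_eq_integral_add_finsum_collisionJump_td` removes windows,
reference switching and the within-window commutator, hence removes the a-priori cubic-moment / transfer-activity inputs S7/T′
from the BOOKKEEPING). The integrand — the one-body entropy production `(∂_r + v·∇_x) g_r` of the reference log-density — splits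
by a POLYNOMIAL IDENTITY (proved below by `ring`, `oneBodyProduction_decomposition`, the primitive hard-sphere Euler equations in,
nothing else) into
* `Y⊥`: the Navier–Stokes/Fourier currents orthogonal to the collision invariants — traceless peculiar stress against `∇u/θ` and
  the kinetic heat current `(|c|² − 5θ)c` against `∇θ/(2θ²)` (the Chapman–Enskog driving terms; this is ALL that survives for the
  ideal gas `Z ≡ 1`);
* `Ylin`: `(1 − Z)·[c·∇θ/θ + (|c|² − 3θ) div u/(3θ)]` — linear in the momentum/energy fluctuations, the linear response of the
  COLLISIONAL flux that the collisional transfer must cancel;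
* `Y0`: `−((Z − 1) + ρσ³Z′) div u` — the density response of the excess pressure.
The crux then follows from TWO mean one-block bounds along the TRUE flow, each ONE-SIDED, FIRST-MOMENT, on arbitrary macroscopic
sub-intervals `[s, s′] ⊂ [0, t]`, with an entropy allowance `C ∫_s^{s′} H_N`:
* `stub_kineticOneBlockInMean` (P3, THE KINETIC HEART): `−E[∫_s^{s′} Σ_i Y⊥_r(z_i(r)) dr] ≤ C∫H + ε(N+1)`;
* `stub_collisionalOneBlockInMean` (P4, the collisional heart): `−E[Σ_{collisions in (s,s′]} jump of G_{r_c}] − E[∫Σ(Ylin+Y0)] +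
  Δ log Z_pos ≤ C∫H + ε(N+1)` (collisional transfer of the time-dependent reference observable against its exact counter-terms),
by a macroscopic-time Grönwall (`stub_meanGronwall`, provable glue: B1 + the decomposition + `H_N(0) = 0` from the landed time-zero
reference + `klDiv ≠ ⊤`), the landed reference identification G3, the landed core reduction S2 and the landed dock S1.

## What it buys against the registered line (at its STUCK point)

The lead's open content (skeleton v7, docked to the sibling ClampedCurrentsDock 14680) is `stub_inputs = C′ ∧ CollisionEnergyActivityTails
∧ CoherentSuprathermalContentVanishes ∧ KCWU ∧ CAT ∧ ECT` (EXPONENTIAL-MOMENT window-LD / tail inputs under local Gibbs references on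
KINETIC windows: C′ refuted-and-repaired with clamps at fixed `V`; kinetic window LD at a fixed cut-off plus a suprathermal-content bet;
v6's alternative end needs an amplitude threshold uniform over the quadratic class because of the cut-off race `e^{tCM/κ}` vs `e^{-cM²}`)
+ R3 (localisation, XL) + the XL window heart `stub_ledgerIntegratedInBand`. Here:
(i) no exponential moment, no velocity cut-off, no clamp, no kinetic window occurs in ANY statement — the barrier
`HighMomentumCutoffBarrier(Narrow)` is not met (the cubic heat current lives inside P3 in `L¹` along the true flow);
(ii) the two open stubs are strictly weaker than what the lead's inputs deliver (entropy inequality + S4′ + S7 ⇒ P3; entropy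
inequality + R3∘C′ + T′ ⇒ P4) and are MECHANISM-NEUTRAL: P3 is exactly the docking point for the mean-current transfer targets of
the crux ideas `shell-stosszahlansatz` (`KineticCurrentErgodicityInBand` + heat-flux twin, via OVY space–time averaging) and
`collision-information-ledger` (`⟨C_in⟩ → 0`), which so far have NO composition concluding the crux; P4 is the docking point for
contact-statistics statements (`CollisionalFluxLocality`-type, JaynesSqueeze K2 logic: time-integrated contact functionals are bulk);
(iii) the kinetic and collisional halves are separately registered, so a disprover can target either.
Honest cost: P3 and P4 are f-DEPENDENT (means along the true evolution); the entropy-inequality route to them re-introduces windows and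
exponential moments INSIDE a proof — the line does not claim to have removed the dynamical content, only to have typed it in its weakest
consumable (first-moment, one-sided, in-band) form.

## Stubs (registered; `sorry` only inside them) — hardest: `stub_kineticOneBlockInMean`

* `stub_continuousEntropyBalance` (B1, provable now, M–L): finiteness, continuity in `s`, and the exact balance identity with the
  time-dependent reference (from `EntropyClockDock.toReal_klDiv_lawAt_eq_integral` + the landed `_td` trajectory balance).
* `stub_kineticOneBlockInMean` (P3, OPEN — kinetic heart).
* `stub_collisionalOneBlockInMean` (P4, OPEN — collisional heart; plausibly L CONDITIONAL on entropy smallness over the interval).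
* `stub_meanGronwall` (G, provable now, M): B1 → P3 → P4 → `CoreAlongExplicitReference` (integral Grönwall on `[0,t]`,
  `H_N(0) = 0` by `QuenchedCellClock.stub_timeZeroReference` + `klDiv_lawAt_zero_localGibbsLaw`, the decomposition along the flow by
  `oneBodyProduction_decomposition` + `HydroLimitInBandClock.hsEuler_primitiveInBand`).
PROVED here: `oneBodyProduction_decomposition` (the cut between P3 and P4 is certified algebra), `gronwallCoreBody_of_core`
(G3 swap + `ℝ≥0∞` bookkeeping), and the composition `HydroLimitInBand_of` concluding the crux BY NAME.

Disproof used (`Cruxes/HydroLimitInBand/Disproof.lean` @ 2026-08-16T12:22Z): §3 load-bearing list honoured — all three balance laws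
enter P3/P4 through the primitive Euler equations inside `oneBodyProduction_decomposition` (drop one and the identity is false: the
`ring` check fails), joint smoothness through the smooth reference family, the tie through `stub_timeZeroReference` (`H_N(0)=0`),
`0 < σ` through the collision term of P4 (at `σ = 0` there are no jumps and P4 reduces to `Δ log Z_pos − E∫Σ(Ylin+Y0) ≤ …`, which
is FALSE along the free-streaming shear of §8 — consistent with `hydroLimitInBand_false_with_sigma_zero`); §6.1–6.3 WLOG's used
(σ ≤ 1/2, one flow family, smooth profiles); §5 no Targets registered. Negatives index: no refuted statement is an instance of P3/P4
(14607 ExpTailBudget: no exponential tail budget here; 13733: no clamp here; 9168: every EOS term is tied and guarded).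
-/

noncomputable section

open MeasureTheory Filter Set Topology InformationTheory
open scoped ENNReal

namespace Summit.AtomisticToContinuum.HydrodynamicLimit.Cruxes.HydroLimitInBand.MeanCurrentBalance

open Literature.MathematicalPhysics.KineticTheory Literature.Analysis.FluidPDE Literature.Analysis.FunctionSpaces
open Summit.AtomisticToContinuum.HydrodynamicLimit.Theses

/-! ## §0 The one-body objects of the line -/

/-- The reference one-body log-density `g(x,v) = log b(x) − (3/2) log(2πϑ(x)) − ‖v − w(x)‖²/(2ϑ(x))` of the local Gibbs law
`localGibbsLaw σ b w ϑ` (so that `Σ_i g(z_i) − log Z_pos(b)` is its log-density on the hard-sphere domain; same observable as the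
lead's R1). -/
def refObs (b ϑ : T3 → ℝ) (w : T3 → V3) (y : T3 × V3) : ℝ :=
  Real.log (b y.1) - 3 / 2 * Real.log (2 * Real.pi * ϑ y.1) - ‖y.2 - w y.1‖ ^ 2 / (2 * ϑ y.1)

/-- The reference observable `G(z) = Σ_i g(z_i)`. -/
def refSum {n : ℕ} (b ϑ : T3 → ℝ) (w : T3 → V3) (z : Config n (Fin 3) T3) : ℝ :=
  ∑ i, refObs b ϑ w (z i)

/-- The one-body ENTROPY PRODUCTION of a time-dependent reference family at time `r` and one-particle state `y = (x, v)`: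
`(∂_r g_r)(x, v) + (v · ∇_x) g_r(x, v)` (explicit time derivative of the reference log-density plus its free-streaming derivative,
`Torus.fderiv` applied to the particle's own velocity). -/
def Dref (b ϑ : ℝ → T3 → ℝ) (w : ℝ → T3 → V3) (r : ℝ) (y : T3 × V3) : ℝ :=
  deriv (fun r' => refObs (b r') (ϑ r') (w r') y) r +
    Torus.fderiv (fun x => refObs (b r) (ϑ r) (w r) (x, y.2)) y.1 y.2

/-- `Y⊥` — the kinetic currents ORTHOGONAL to the collision invariants in `L²` of the local Maxwellian, tested against the
gradients of the reference fields: traceless peculiar stress against `∇w/ϑ` plus the kinetic heat current `(‖c‖² − 5ϑ)c` against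
`∇ϑ/(2ϑ²)`, `c = v − w(x)` (Chapman–Enskog driving terms). -/
def Yperp (ϑ : T3 → ℝ) (w : T3 → V3) (y : T3 × V3) : ℝ :=
  (∑ k : Fin 3, ∑ j : Fin 3, (Torus.partialDeriv k w y.1) j *
      ((y.2 - w y.1) k * (y.2 - w y.1) j - if k = j then ‖y.2 - w y.1‖ ^ 2 / 3 else 0)) / ϑ y.1 +
    (∑ k : Fin 3, Torus.partialDeriv k ϑ y.1 * (y.2 - w y.1) k) * (‖y.2 - w y.1‖ ^ 2 - 5 * ϑ y.1) /
      (2 * ϑ y.1 ^ 2)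

/-- `Ylin` — the part of the production LINEAR in the momentum / energy fluctuations with coefficient `1 − Z(ρσ³)`: the linear
response of the collisional flux, to be cancelled by the collisional transfer (it vanishes for the ideal gas). -/
def Ylin (σ : ℝ) (ρ ϑ : T3 → ℝ) (w : T3 → V3) (y : T3 × V3) : ℝ :=
  (1 - hsCompressibility (ρ y.1 * σ ^ 3)) *
    ((∑ k : Fin 3, Torus.partialDeriv k ϑ y.1 * (y.2 - w y.1) k) / ϑ y.1 +
      (‖y.2 - w y.1‖ ^ 2 - 3 * ϑ y.1) * Torus.divergence w y.1 / (3 * ϑ y.1))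

/-- `Y0` — the density response of the excess pressure: `−((Z − 1) + ρσ³ Z′) div w` at the particle's position. -/
def Yzero (σ : ℝ) (ρ : T3 → ℝ) (w : T3 → V3) (x : T3) : ℝ :=
  -((hsCompressibility (ρ x * σ ^ 3) - 1) + ρ x * σ ^ 3 * deriv hsCompressibility (ρ x * σ ^ 3)) *
    Torus.divergence w x

/-- The explicit reference activity of the line (same as the lead's glue): `b_s = ρ_s · Rf(σ³ρ_s)`. -/
def bref (Rf : ℝ → ℝ) (σ : ℝ) (ρ : ℝ → T3 → ℝ) (s : ℝ) (x : T3) : ℝ :=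
  ρ s x * Rf (σ ^ 3 * ρ s x)

/-- The relative entropy of the true law at time `s` with respect to the explicit reference, real-valued:
`H_N(s) = KL(lawAt Φ λ_N s ‖ localGibbsLaw σ b_s u_s θ_s).toReal`. -/
def Href (σ : ℝ) (a₀ θ₀ : T3 → ℝ) (u₀ : T3 → V3) (Rf : ℝ → ℝ) (ρ θ : ℝ → T3 → ℝ) (u : ℝ → T3 → V3)
    (N : ℕ) (Φ : HardSphereFlow (Torus.geometry (Fin 3)) (hsDiameter σ N) (N + 1)) (s : ℝ) : ℝ :=
  (klDiv (Φ.lawAt (localGibbsLaw σ a₀ u₀ θ₀ N Φ) s)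
    (localGibbsLaw σ (bref Rf σ ρ s) (u s) (θ s) N Φ)).toReal

/-- The collisional transfer over `(s, s′]` of the TIME-DEPENDENT reference observable along the orbit of `z`:
`Σ_{r_c ∈ C ∩ (s,s′]} [G_{r_c}(γ r_c) − G_{r_c}(γ r_c⁻)]` (the finsum of the landed `_td` balance law). -/
def refJumps (σ : ℝ) (Rf : ℝ → ℝ) (ρ θ : ℝ → T3 → ℝ) (u : ℝ → T3 → V3) (N : ℕ)
    (Φ : HardSphereFlow (Torus.geometry (Fin 3)) (hsDiameter σ N) (N + 1)) (s s' : ℝ)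
    (z : Config (N + 1) (Fin 3) T3) : ℝ :=
  ∑ᶠ rc ∈ collisionTimes (Torus.geometry (Fin 3)) (hsDiameter σ N) (fun r => Φ.flow r z) ∩ Set.Ioc s s',
    collisionJump (refSum (bref Rf σ ρ rc) (θ rc) (u rc)) (fun r => Φ.flow r z) rc

/-! ## §1 The certified cut: the one-body production splits as `Y⊥ + Ylin + Y0` (polynomial identity)

Variables at one space–time point: `ρ, θ ≠ 0`, `χ = Z(ρσ³)`, `dχ = χ′(ρ)` (so `ρ dχ = ρσ³Z′`), time derivatives `ρt, θt, ut`,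
space derivatives `dρ k = ∂_kρ`, `dθ k = ∂_kθ`, `du k j = ∂_k u_j`, the thermodynamically consistent activity
`∂ log b = ((χ + ρ dχ)/ρ) ∂ρ` (Gibbs–Duhem, as in the lead's `hsEuler_entropyVariable_identity`), a particle velocity `v` and its
peculiar velocity `c = v − u`. Hypotheses = the primitive hard-sphere Euler equations at the point (continuity, Euler, temperature:
landed `HydroLimitInBandClock.hsEuler_primitiveInBand`). Dropping any one of them breaks the identity (the `ring` check fails), which is
how §3 of the Disproof ("every balance law is load-bearing") is honoured by the cut itself. -/

/-- **The one-body entropy production decomposes as `Y⊥ + Ylin + Y0` (polynomial form).** [folklore] -/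
theorem oneBodyProduction_decomposition (ρ θ χ dχ ρt θt : ℝ) (u ut dρ dθ v : Fin 3 → ℝ)
    (du : Fin 3 → Fin 3 → ℝ) (hρ : ρ ≠ 0) (hθ : θ ≠ 0)
    (hP1 : ρt = -(∑ k, u k * dρ k) - ρ * ∑ k, du k k)
    (hP2 : ∀ j, ut j = -(∑ k, u k * du k j) - ρ⁻¹ * (θ * (χ + ρ * dχ) * dρ j + ρ * χ * dθ j))
    (hP3 : θt = -(∑ k, u k * dθ k) - 2 / 3 * θ * χ * ∑ k, du k k) :
    let κ : ℝ := χ + ρ * dχ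
    let c : Fin 3 → ℝ := fun j => v j - u j
    let csq : ℝ := ∑ j, c j ^ 2
    -- (∂_r + v·∇) of `log b − (3/2) log(2πθ) − |v − u|²/(2θ)` with `∂ log b = (κ/ρ) ∂ρ`
    let production : ℝ :=
      κ / ρ * (ρt + ∑ k, v k * dρ k) - 3 / (2 * θ) * (θt + ∑ k, v k * dθ k) +
        (∑ j, c j / θ * (ut j + ∑ k, v k * du k j)) + csq / (2 * θ ^ 2) * (θt + ∑ k, v k * dθ k)
    let Yp : ℝ :=
      (∑ k, ∑ j, du k j * (c k * c j - if k = j then csq / 3 else 0)) / θ +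
        (∑ k, dθ k * c k) * (csq - 5 * θ) / (2 * θ ^ 2)
    let Yl : ℝ := (1 - χ) * ((∑ k, dθ k * c k) / θ + (csq - 3 * θ) * (∑ k, du k k) / (3 * θ))
    let Yz : ℝ := -((χ - 1) + ρ * dχ) * ∑ k, du k k
    production = Yp + Yl + Yz := by
  intro κ c csq production Yp Yl Yz
  simp only [production, Yp, Yl, Yz, κ, csq, c, Fin.sum_univ_three, Fin.isValue, Fin.reduceEq, if_true, if_false]
  simp only [Fin.sum_univ_three] at hP1 hP2 hP3
  have h20 := hP2 0
  have h21 := hP2 1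
  have h22 := hP2 2
  rw [hP1, hP3, h20, h21, h22]
  field_simp
  ring

/-! ## §2 The typed statements of the line

Common frame (verbatim the lead's heart frame, so that the glue to `GronwallCoreInBand` is the same): an insertion factor `Rf`
analytic on the ball of radius `r` with its defining properties (produced by the landed `Theorems.stub_eosRatioAnalytic`);
`∃ η_h > 0`; continuous positive profiles; `∃ σ₀`; `0 < σ < σ₀`; a classical hs-Euler solution on `[0,T)` with packing `< η_h`
throughout; a flow family; the `t = 0` tie; `t ∈ (0, T)`. -/

/-- **B1 = `ContinuousEntropyBalanceInBand` (provable now, M–L).** In the frame, for every `N`: (i) `H_N(s) < ∞` on `[0,t]`;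
(ii) `s ↦ H_N(s)` is continuous on `[0,t]`; (iii) for `0 ≤ s ≤ s′ ≤ t` the EXACT balance
`H_N(s′) − H_N(s) = −E_{λ_N}[∫_s^{s′} Σ_i Dref_r(z_i(r)) dr] − E_{λ_N}[refJumps(s,s′)] + log Z_pos(b_{s′}) − log Z_pos(b_s)`.
Ingredients, all landed: `EntropyClockDock.toReal_klDiv_lawAt_eq_integral` (KL along the flow as an explicit integral, Liouville),
`IsHardSphereTrajectory.sub_eq_integral_add_finsum_collisionJump_td` (trajectory balance for time-dependent observables),
Gaussian/energy integrability under `λ_N` (`integrable_sum_norm_sq_flow`), smoothness in `(s,x)` of the reference in band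
(analytic `Rf`, smooth Euler slices), dominated convergence for (ii). -/
def ContinuousEntropyBalanceInBand : Prop :=
  ∀ (r : ℝ) (Rf : ℝ → ℝ), 0 < r →
    (∃ p : FormalMultilinearSeries ℝ ℝ ℝ, HasFPowerSeriesOnBall Rf p 0 (ENNReal.ofReal r)) →
    (∀ x ∈ Set.Ioo (-r) r, 0 < Rf x ∧ Rf x * (∑' j : ℕ, bE j / (j.factorial : ℝ) * (x * Rf x) ^ j) = 1) →
    (∀ x ∈ Set.Icc 0 r, 1 ≤ Rf x ∧ Rf x ≤ 2) → ContinuousOn Rf (Set.Icc 0 r) →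
    (∀ x ∈ Set.Ioo (-r) r, ∀ R ∈ Set.Icc (1 / 2 : ℝ) 2,
      R * (∑' j : ℕ, bE j / (j.factorial : ℝ) * (x * R) ^ j) = 1 → R = Rf x) →
  ∃ ηh : ℝ, 0 < ηh ∧ ∀ (a₀ θ₀ : T3 → ℝ) (u₀ : T3 → V3), Continuous a₀ → Continuous θ₀ → Continuous u₀ →
    (∀ x, 0 < a₀ x) → (∀ x, 0 < θ₀ x) → ∃ σ₀ : ℝ, 0 < σ₀ ∧ ∀ σ : ℝ, 0 < σ → σ < σ₀ →
    ∀ (T : ℝ) (ρ θ : ℝ → T3 → ℝ) (u : ℝ → T3 → V3), IsHardSphereEulerSolution σ T ρ u θ →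
    (∀ t ∈ Set.Ico 0 T, ∀ x, ρ t x * σ ^ 3 < ηh) →
    ∀ Φ : (N : ℕ) → HardSphereFlow (Torus.geometry (Fin 3)) (hsDiameter σ N) (N + 1),
    TendstoHydroFieldsAt (fun N => localGibbsLaw σ a₀ u₀ θ₀ N (Φ N)) Φ ρ u θ 0 →
    ∀ t ∈ Set.Ioo 0 T, ∀ N : ℕ,
      (∀ s ∈ Set.Icc 0 t,
        klDiv ((Φ N).lawAt (localGibbsLaw σ a₀ u₀ θ₀ N (Φ N)) s)
          (localGibbsLaw σ (bref Rf σ ρ s) (u s) (θ s) N (Φ N)) ≠ ⊤) ∧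
      ContinuousOn (Href σ a₀ θ₀ u₀ Rf ρ θ u N (Φ N)) (Set.Icc 0 t) ∧
      ∀ s s' : ℝ, 0 ≤ s → s ≤ s' → s' ≤ t →
        Href σ a₀ θ₀ u₀ Rf ρ θ u N (Φ N) s' - Href σ a₀ θ₀ u₀ Rf ρ θ u N (Φ N) s =
          -(∫ z, (∫ r in s..s', ∑ i, Dref (bref Rf σ ρ) θ u r ((Φ N).flow r z i))
              ∂(localGibbsLaw σ a₀ u₀ θ₀ N (Φ N))) -
            (∫ z, refJumps σ Rf ρ θ u N (Φ N) s s' z ∂(localGibbsLaw σ a₀ u₀ θ₀ N (Φ N))) +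
            (Real.log (posPartition (bref Rf σ ρ s') (hsDiameter σ N) (N + 1)) -
              Real.log (posPartition (bref Rf σ ρ s) (hsDiameter σ N) (N + 1)))

/-- **P3 = `KineticOneBlockInMeanInBand` (OPEN — THE KINETIC HEART).** In the frame, for every `t ∈ (0,T)` there is `C ≥ 0`
such that for every `ε > 0`, eventually in `N`, on EVERY sub-interval `[s,s′] ⊂ [0,t]` the mean of the time-integrated orthogonal
kinetic current along the TRUE flow is bounded below:
`−E_{λ_N}[∫_s^{s′} Σ_i Y⊥_r(x_i(r), v_i(r)) dr] ≤ C ∫_s^{s′} H_N(r) dr + ε (N+1)`.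
Informally: the traceless peculiar stress tested against `∇u_r/θ_r` and the kinetic heat current tested against `∇θ_r/(2θ_r²)` have
mean `O(entropy) + o(N)` along the evolution — isotropy and vanishing heat flux IN MEAN, with the one-block entropy allowance.
ONE-SIDED and FIRST-MOMENT: no exponential moment, window, cut-off or clamp is part of the statement (the cubic heat current is in
`L¹(f_r)`). Fed by: entropy inequality + window LD under local Gibbs + Gaussian tails (the lead's S4′, S7); OR OVY space–time
averaging + the mean-current Boltzmann hypothesis in band (`KineticCurrentErgodicityInBand` + heat-flux twin, crux idea
`shell-stosszahlansatz`); OR the collision information ledger (`⟨C_in⟩ → 0`, crux idea `collision-information-ledger`).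
Why it might fail: it is the kinetic half of the conjunct's dissipative content — false iff deterministic spheres at fixed small
packing keep an `O(1)` mean anisotropic stress / heat flux before the shock (an `O(1)` effective viscosity at Euler scaling, or
ballistic energy carried in the cubic tail: HighMomentumCutoff in `L¹` form). -/
def KineticOneBlockInMeanInBand : Prop :=
  ∀ (r : ℝ) (Rf : ℝ → ℝ), 0 < r →
    (∃ p : FormalMultilinearSeries ℝ ℝ ℝ, HasFPowerSeriesOnBall Rf p 0 (ENNReal.ofReal r)) →
    (∀ x ∈ Set.Ioo (-r) r, 0 < Rf x ∧ Rf x * (∑' j : ℕ, bE j / (j.factorial : ℝ) * (x * Rf x) ^ j) = 1) →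
    (∀ x ∈ Set.Icc 0 r, 1 ≤ Rf x ∧ Rf x ≤ 2) → ContinuousOn Rf (Set.Icc 0 r) →
    (∀ x ∈ Set.Ioo (-r) r, ∀ R ∈ Set.Icc (1 / 2 : ℝ) 2,
      R * (∑' j : ℕ, bE j / (j.factorial : ℝ) * (x * R) ^ j) = 1 → R = Rf x) →
  ∃ ηh : ℝ, 0 < ηh ∧ ∀ (a₀ θ₀ : T3 → ℝ) (u₀ : T3 → V3), Continuous a₀ → Continuous θ₀ → Continuous u₀ →
    (∀ x, 0 < a₀ x) → (∀ x, 0 < θ₀ x) → ∃ σ₀ : ℝ, 0 < σ₀ ∧ ∀ σ : ℝ, 0 < σ → σ < σ₀ →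
    ∀ (T : ℝ) (ρ θ : ℝ → T3 → ℝ) (u : ℝ → T3 → V3), IsHardSphereEulerSolution σ T ρ u θ →
    (∀ t ∈ Set.Ico 0 T, ∀ x, ρ t x * σ ^ 3 < ηh) →
    ∀ Φ : (N : ℕ) → HardSphereFlow (Torus.geometry (Fin 3)) (hsDiameter σ N) (N + 1),
    TendstoHydroFieldsAt (fun N => localGibbsLaw σ a₀ u₀ θ₀ N (Φ N)) Φ ρ u θ 0 →
    ∀ t ∈ Set.Ioo 0 T, ∃ C : ℝ, 0 ≤ C ∧ ∀ ε : ℝ, 0 < ε → ∃ N₀ : ℕ, ∀ N : ℕ, N₀ ≤ N →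
      ∀ s s' : ℝ, 0 ≤ s → s ≤ s' → s' ≤ t →
        -(∫ z, (∫ r in s..s', ∑ i, Yperp (θ r) (u r) ((Φ N).flow r z i))
            ∂(localGibbsLaw σ a₀ u₀ θ₀ N (Φ N))) ≤
          C * (∫ r in s..s', Href σ a₀ θ₀ u₀ Rf ρ θ u N (Φ N) r) + ε * ((N : ℝ) + 1)

/-- **P4 = `CollisionalOneBlockInMeanInBand` (OPEN — the collisional heart).** In the frame, for every `t ∈ (0,T)` there is
`C ≥ 0` such that for every `ε > 0`, eventually in `N`, on every `[s,s′] ⊂ [0,t]`: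
`−E_{λ_N}[refJumps(s,s′)] − E_{λ_N}[∫_s^{s′} Σ_i (Ylin_r + Y0_r)(z_i(r)) dr] + (log Z_pos(b_{s′}) − log Z_pos(b_s))`
`≤ C ∫_s^{s′} H_N(r) dr + ε (N+1)`:
the mean collisional transfer of the (time-dependent) reference observable, MINUS its exact one-body linear response (`Ylin`: momentum
and temperature response of the excess pressure `ρθ(Z − 1)`; `Y0`: density response) and normalised by the statics
(`(log Z_pos)′ = E_ψ[Σ ∂_r log b_r]`; under the reference the three terms cancel EXACTLY at finite `N` because
`∫ L_N(e^{G}) = 0` for the Liouville operator and `E_ψ[Y⊥] = E_ψ[Ylin] = 0` conditionally on positions), is `O(entropy) + o(N)`.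
This is the contact-statistics half: TRUE iff the collisional momentum/energy transfer responds to one-body deviations as local
equilibrium predicts, up to `C·H`. Fed by: entropy inequality + the localised clamped transfer LD + transfer-activity tails (the lead's
R3∘C′, T′); OR a conditional contact-locality theorem (JaynesSqueeze `CollisionalFluxLocality` logic: time-integrated contact
functionals are bulk quantities of a law that is entropy-close to local Gibbs over the interval; CIP §4.3, GST Ch. 4).
Why it might fail: specific relative entropy `o(N)` at fixed times does not see codimension-one contact statistics — a persistent
`O(1)` distortion of the pair density at contact costs `o(N)` entropy yet changes the collisional pressure by an `O(1)` factor; the bet is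
that the TIME-INTEGRATED transfer is bulk. No clamp: first moments tolerate the polynomial collision-count tails (cages) that forced
the clamp into C′. -/
def CollisionalOneBlockInMeanInBand : Prop :=
  ∀ (r : ℝ) (Rf : ℝ → ℝ), 0 < r →
    (∃ p : FormalMultilinearSeries ℝ ℝ ℝ, HasFPowerSeriesOnBall Rf p 0 (ENNReal.ofReal r)) →
    (∀ x ∈ Set.Ioo (-r) r, 0 < Rf x ∧ Rf x * (∑' j : ℕ, bE j / (j.factorial : ℝ) * (x * Rf x) ^ j) = 1) →
    (∀ x ∈ Set.Icc 0 r, 1 ≤ Rf x ∧ Rf x ≤ 2) → ContinuousOn Rf (Set.Icc 0 r) →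
    (∀ x ∈ Set.Ioo (-r) r, ∀ R ∈ Set.Icc (1 / 2 : ℝ) 2,
      R * (∑' j : ℕ, bE j / (j.factorial : ℝ) * (x * R) ^ j) = 1 → R = Rf x) →
  ∃ ηh : ℝ, 0 < ηh ∧ ∀ (a₀ θ₀ : T3 → ℝ) (u₀ : T3 → V3), Continuous a₀ → Continuous θ₀ → Continuous u₀ →
    (∀ x, 0 < a₀ x) → (∀ x, 0 < θ₀ x) → ∃ σ₀ : ℝ, 0 < σ₀ ∧ ∀ σ : ℝ, 0 < σ → σ < σ₀ →
    ∀ (T : ℝ) (ρ θ : ℝ → T3 → ℝ) (u : ℝ → T3 → V3), IsHardSphereEulerSolution σ T ρ u θ →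
    (∀ t ∈ Set.Ico 0 T, ∀ x, ρ t x * σ ^ 3 < ηh) →
    ∀ Φ : (N : ℕ) → HardSphereFlow (Torus.geometry (Fin 3)) (hsDiameter σ N) (N + 1),
    TendstoHydroFieldsAt (fun N => localGibbsLaw σ a₀ u₀ θ₀ N (Φ N)) Φ ρ u θ 0 →
    ∀ t ∈ Set.Ioo 0 T, ∃ C : ℝ, 0 ≤ C ∧ ∀ ε : ℝ, 0 < ε → ∃ N₀ : ℕ, ∀ N : ℕ, N₀ ≤ N →
      ∀ s s' : ℝ, 0 ≤ s → s ≤ s' → s' ≤ t →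
        -(∫ z, refJumps σ Rf ρ θ u N (Φ N) s s' z ∂(localGibbsLaw σ a₀ u₀ θ₀ N (Φ N))) -
            (∫ z, (∫ r in s..s', ∑ i, (Ylin σ (ρ r) (θ r) (u r) ((Φ N).flow r z i) +
                Yzero σ (ρ r) (u r) ((Φ N).flow r z i).1)) ∂(localGibbsLaw σ a₀ u₀ θ₀ N (Φ N))) +
            (Real.log (posPartition (bref Rf σ ρ s') (hsDiameter σ N) (N + 1)) -
              Real.log (posPartition (bref Rf σ ρ s) (hsDiameter σ N) (N + 1))) ≤
          C * (∫ r in s..s', Href σ a₀ θ₀ u₀ Rf ρ θ u N (Φ N) r) + ε * ((N : ℝ) + 1)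

/-- **The line's C⁺ = `CoreAlongExplicitReference`:** in the frame, for every `t ∈ (0,T)`, the relative entropy with respect to the
explicit reference is finite for every `N` and `H_N(t)/(N+1) → 0`. (The in-band Yau estimate along the explicit reference family;
the landed G3 turns it into the body of the lead's `GronwallCoreInBand`, see `gronwallCoreBody_of_core`.) -/
def CoreAlongExplicitReference : Prop :=
  ∀ (r : ℝ) (Rf : ℝ → ℝ), 0 < r →
    (∃ p : FormalMultilinearSeries ℝ ℝ ℝ, HasFPowerSeriesOnBall Rf p 0 (ENNReal.ofReal r)) →
    (∀ x ∈ Set.Ioo (-r) r, 0 < Rf x ∧ Rf x * (∑' j : ℕ, bE j / (j.factorial : ℝ) * (x * Rf x) ^ j) = 1) →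
    (∀ x ∈ Set.Icc 0 r, 1 ≤ Rf x ∧ Rf x ≤ 2) → ContinuousOn Rf (Set.Icc 0 r) →
    (∀ x ∈ Set.Ioo (-r) r, ∀ R ∈ Set.Icc (1 / 2 : ℝ) 2,
      R * (∑' j : ℕ, bE j / (j.factorial : ℝ) * (x * R) ^ j) = 1 → R = Rf x) →
  ∃ ηh : ℝ, 0 < ηh ∧ ∀ (a₀ θ₀ : T3 → ℝ) (u₀ : T3 → V3), Continuous a₀ → Continuous θ₀ → Continuous u₀ →
    (∀ x, 0 < a₀ x) → (∀ x, 0 < θ₀ x) → ∃ σ₀ : ℝ, 0 < σ₀ ∧ ∀ σ : ℝ, 0 < σ → σ < σ₀ →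
    ∀ (T : ℝ) (ρ θ : ℝ → T3 → ℝ) (u : ℝ → T3 → V3), IsHardSphereEulerSolution σ T ρ u θ →
    (∀ t ∈ Set.Ico 0 T, ∀ x, ρ t x * σ ^ 3 < ηh) →
    ∀ Φ : (N : ℕ) → HardSphereFlow (Torus.geometry (Fin 3)) (hsDiameter σ N) (N + 1),
    TendstoHydroFieldsAt (fun N => localGibbsLaw σ a₀ u₀ θ₀ N (Φ N)) Φ ρ u θ 0 →
    ∀ t ∈ Set.Ioo 0 T,
      (∀ N : ℕ, klDiv ((Φ N).lawAt (localGibbsLaw σ a₀ u₀ θ₀ N (Φ N)) t)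
          (localGibbsLaw σ (bref Rf σ ρ t) (u t) (θ t) N (Φ N)) ≠ ⊤) ∧
      Tendsto (fun N : ℕ => Href σ a₀ θ₀ u₀ Rf ρ θ u N (Φ N) t / ((N : ℝ) + 1)) atTop (𝓝 0)

/-! ## §3 Stubs -/

/-- **B1 (provable now, M–L).** The exact entropy balance with the time-dependent explicit reference, with finiteness and continuity. -/
theorem stub_continuousEntropyBalance : ContinuousEntropyBalanceInBand := by
  sorry

/-- **P3 (OPEN; the kinetic heart; hardest stub).** Mean orthogonal kinetic current along the true flow `≤ C∫H + ε(N+1)`. -/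
theorem stub_kineticOneBlockInMean : KineticOneBlockInMeanInBand := by
  sorry

/-- **P4 (OPEN; the collisional heart).** Mean collisional transfer of the reference observable minus its linear response and statics
`≤ C∫H + ε(N+1)`. -/
theorem stub_collisionalOneBlockInMean : CollisionalOneBlockInMeanInBand := by
  sorry

/-- **G (provable now, M) — the macroscopic-time Grönwall.** From B1 (identity, finiteness, continuity), the decomposition
`Dref = Y⊥ + Ylin + Y0` along the flow (instantiate `oneBodyProduction_decomposition` with the primitive equations of
`HydroLimitInBandClock.hsEuler_primitiveInBand` and `∂ log b_r = ((Z + ρσ³Z′)/ρ) ∂ρ_r` for `b = ρ·Rf(σ³ρ)` in the cluster radius —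
`R2OneModeTwoConditions.excessChemicalPotential_eq_log` / `insertionFactor_package`), P3 and P4:
`H_N(s′) ≤ H_N(s) + 2C ∫_s^{s′} H_N + 2ε(N+1)` for all `0 ≤ s ≤ s′ ≤ t`, `N ≥ N₀(ε)`; with `H_N(0) = 0`
(`QuenchedCellClock.stub_timeZeroReference` + `EntropyClockDock.klDiv_lawAt_zero_localGibbsLaw`) and continuity, the integral form of
Grönwall gives `H_N(t) ≤ 2ε(N+1)e^{2Ct}`, i.e. `limsup_N H_N(t)/(N+1) ≤ 2εe^{2Ct}` for every `ε > 0`. Thresholds: `η_h := min` of the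
three, `σ₀ := min` of the three and of the time-zero threshold. -/
theorem stub_meanGronwall :
    ContinuousEntropyBalanceInBand → KineticOneBlockInMeanInBand → CollisionalOneBlockInMeanInBand →
      CoreAlongExplicitReference := by
  sorry

/-! ## §4a Reference identification in band (G3) — local sorry-free copy

Verbatim the landed `EntropyClockDock.referenceIdentificationInBand`
(`Theorems/ImplosionDichotomyHydroLimitInBandReferenceIdentification.lean`), re-proved here from its (older, built) imports so that
this skeleton elaborates on farm snapshots that predate that module; provers should cite the Theorems copy. -/

open Summit.AtomisticToContinuum.HydrodynamicLimit.Theorems.PolynomialCompressionStatics in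
/-- **G3 — reference identification in band** (local copy of the landed theorem; same statement, same proof). [folklore] -/
theorem referenceIdentificationInBand' :
    ∀ (r : ℝ) (Rf : ℝ → ℝ), 0 < r →
    (∀ x ∈ Set.Ioo (-r) r, ∀ R ∈ Set.Icc (1 / 2 : ℝ) 2,
      R * (∑' j : ℕ, bE j / (j.factorial : ℝ) * (x * R) ^ j) = 1 → R = Rf x) →
    ∀ σ : ℝ, 0 < σ → ∀ (ρ a : T3 → ℝ) (hac : Continuous a) (hap : ∀ x, 0 < a x),
      Continuous ρ → (∀ x, 0 < ρ x) →
      (∀ x, ρ x ≤ a x ∧ a x ≤ 2 * ρ x) → SmallDensity (profileOf a hac hap) σ →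
      rhoLim (profileOf a hac hap) σ = ρ → 6 * (σ ^ 3 * ⨆ x, ρ x) < r →
      ∀ (w : T3 → V3) (ϑ : T3 → ℝ) (N : ℕ)
        (Φ : HardSphereFlow (Torus.geometry (Fin 3)) (hsDiameter σ N) (N + 1)),
        localGibbsLaw σ (fun x => ρ x * Rf (σ ^ 3 * ρ x)) w ϑ N Φ = localGibbsLaw σ a w ϑ N Φ := by
  intro r Rf _hr huniq σ hσ ρ a hac hap hρc _hρ0 hale hQs hlim h6 w ϑ N Φ
  set Q := profileOf a hac hap with hQ
  have hρ1 : ∫ x, ρ x = 1 := by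
    rw [← hlim]
    exact integral_rhoLim_eq_one hQs
  have hinta : 1 ≤ ∫ x, a x := by
    have h := integral_mono (integrable_of_continuous_T3 hρc) (integrable_of_continuous_T3 hac)
      fun x => (hale x).1
    linarith [hρ1]
  have hI : 0 < ∫ y, a y := integral_pos_of_continuous_pos hac hap
  have hMQ : Q.M ≤ 2 * ⨆ x, ρ x := Theorems.EntropyClockDock.profileOf_M_le hac hap hρc (fun x => (hale x).2) hinta
  have hσ3 : 0 ≤ σ ^ 3 := pow_nonneg hσ.le 3
  have h3r : 3 * Q.M * σ ^ 3 < r :=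
    calc 3 * Q.M * σ ^ 3 ≤ 3 * (2 * ⨆ x, ρ x) * σ ^ 3 :=
          mul_le_mul_of_nonneg_right (mul_le_mul_of_nonneg_left hMQ (by norm_num)) hσ3
      _ = 6 * (σ ^ 3 * ⨆ x, ρ x) := by ring
      _ < r := h6
  have hrep := Theorems.QuenchedCellClock.rhoLim_mul_Rf_eq huniq hQs h3r
  have hfun : (fun x => ρ x * Rf (σ ^ 3 * ρ x)) = fun x => ratioLimit Q σ / (∫ y, a y) * a x := by
    funext x
    have h2 := (hrep x).2
    rw [hlim] at h2
    rw [h2, hQ, profileOf_β]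
    ring
  have hc : 0 < ratioLimit Q σ / ∫ y, a y := div_pos hQs.ratioLimit_pos hI
  rw [hfun]
  exact Theorems.MacroClosureLine.StubLedger.localGibbsLaw_const_mul Φ a ϑ w hc

/-! ## §4 Glue (sorry-free): C⁺ ⇒ the body of the lead's `GronwallCoreInBand`, by the landed G3 -/

/-- **C⁺ along the explicit reference ⇒ the guarded Grönwall core** (the antecedent of the landed
`EntropyClockDock.relEntropyVanishingInBand_of_gronwallCoreInBand`, unfolded). With the analytic insertion factor of
`Theorems.stub_eosRatioAnalytic`: `η_c := min η_h (r/6)`; for the handed-over activity `a` at time `t` the landed G3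
(`EntropyClockDock.referenceIdentificationInBand`, local copy `referenceIdentificationInBand'`; `6σ³ sup ρ_t < r` from the guard) replaces `localGibbsLaw σ a (u t) (θ t)` by the
explicit reference, and the real limit is returned to `ℝ≥0∞` through the finiteness clause. [cite: Yau1991, §2] -/
theorem gronwallCoreBody_of_core (hW : CoreAlongExplicitReference) :
    ∃ ηc : ℝ, 0 < ηc ∧ ∀ (a₀ θ₀ : T3 → ℝ) (u₀ : T3 → V3), Continuous a₀ → Continuous θ₀ → Continuous u₀ →
    (∀ x, 0 < a₀ x) → (∀ x, 0 < θ₀ x) → ∃ σ₀ : ℝ, 0 < σ₀ ∧ ∀ σ : ℝ, 0 < σ → σ < σ₀ →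
    ∀ (T : ℝ) (ρ θ : ℝ → T3 → ℝ) (u : ℝ → T3 → V3), IsHardSphereEulerSolution σ T ρ u θ →
    (∀ t ∈ Set.Ico 0 T, ∀ x, ρ t x * σ ^ 3 < ηc) →
    ∀ Φ : (N : ℕ) → HardSphereFlow (Torus.geometry (Fin 3)) (hsDiameter σ N) (N + 1),
    TendstoHydroFieldsAt (fun N => localGibbsLaw σ a₀ u₀ θ₀ N (Φ N)) Φ ρ u θ 0 →
    ∀ t ∈ Set.Ioo 0 T, ∀ (a : T3 → ℝ) (hac : Continuous a) (hap : ∀ x, 0 < a x),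
      (∀ x, ρ t x ≤ a x ∧ a x ≤ 2 * ρ t x) → SmallDensity (profileOf a hac hap) σ →
      rhoLim (profileOf a hac hap) σ = ρ t →
      Tendsto (fun N : ℕ => klDiv ((Φ N).lawAt (localGibbsLaw σ a₀ u₀ θ₀ N (Φ N)) t)
        (localGibbsLaw σ a (u t) (θ t) N (Φ N)) / ((N : ℝ≥0∞) + 1)) atTop (𝓝 0) := by
  obtain ⟨r, hr, Rf, hana, -, -, hsol, hbd, hLip, huniq⟩ := Theorems.stub_eosRatioAnalytic
  have hcont : ContinuousOn Rf (Set.Icc 0 r) := by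
    obtain ⟨L, hL⟩ := hLip
    exact hL.continuousOn
  obtain ⟨ηh, hηh, Hh⟩ := hW r Rf hr hana hsol hbd hcont huniq
  refine ⟨min ηh (r / 6), lt_min hηh (by positivity), fun a₀ θ₀ u₀ ha hθ hu ha0 hθ0 => ?_⟩
  obtain ⟨σh, hσh, Hσh⟩ := Hh a₀ θ₀ u₀ ha hθ hu ha0 hθ0
  refine ⟨σh, hσh, ?_⟩
  intro σ hσ hσlt T ρ θ u hE hguard Φ htie t ht a hac hap hale hQs hlim
  have htI : t ∈ Set.Ico 0 T := ⟨ht.1.le, ht.2⟩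
  -- the Euler slice at time `t`
  have hρtc : Continuous (ρ t) := (hE.smooth_density.isSmooth_slice htI).continuous
  have hρtpos : ∀ x, 0 < ρ t x := hE.density_pos t htI
  -- `6 σ³ sup ρ_t < r` from the guard (the `sup` is attained on the compact torus)
  have h6 : 6 * (σ ^ 3 * ⨆ x, ρ t x) < r := by
    have hbdd : BddAbove (Set.range (ρ t)) := (isCompact_range hρtc).bddAbove
    obtain ⟨xM, -, hxM⟩ := isCompact_univ.exists_isMaxOn Set.univ_nonempty hρtc.continuousOn
    have hsup : (⨆ x, ρ t x) = ρ t xM :=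
      le_antisymm (ciSup_le fun x => (isMaxOn_iff.mp hxM) x (Set.mem_univ x)) (le_ciSup hbdd xM)
    have h1 : ρ t xM * σ ^ 3 < r / 6 := (hguard t htI xM).trans_le (min_le_right _ _)
    rw [hsup, mul_comm (σ ^ 3)]
    linarith
  -- G3: the handed-over reference IS the explicit one
  have hlaw : ∀ N : ℕ, localGibbsLaw σ a (u t) (θ t) N (Φ N) =
      localGibbsLaw σ (bref Rf σ ρ t) (u t) (θ t) N (Φ N) := fun N =>
    (referenceIdentificationInBand' r Rf hr huniq σ hσ (ρ t) a hac hap hρtc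
      hρtpos hale hQs hlim h6 (u t) (θ t) N (Φ N)).symm
  simp only [hlaw]
  -- C⁺ along the explicit reference family (packing `< η_h` from the guard)
  obtain ⟨hfin, hreal⟩ := Hσh σ hσ hσlt T ρ θ u hE
    (fun s hs x => (hguard s hs x).trans_le (min_le_left _ _)) Φ htie t ht
  -- back to `ℝ≥0∞`
  have hcongr : ∀ N : ℕ, klDiv ((Φ N).lawAt (localGibbsLaw σ a₀ u₀ θ₀ N (Φ N)) t)
      (localGibbsLaw σ (bref Rf σ ρ t) (u t) (θ t) N (Φ N)) / ((N : ℝ≥0∞) + 1) =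
      ENNReal.ofReal (Href σ a₀ θ₀ u₀ Rf ρ θ u N (Φ N) t / ((N : ℝ) + 1)) := by
    intro N
    have hNpos : (0 : ℝ) < (N : ℝ) + 1 := by positivity
    rw [ENNReal.ofReal_div_of_pos hNpos, Href, ENNReal.ofReal_toReal (hfin N)]
    congr 1
    rw [ENNReal.ofReal_add (by positivity) zero_le_one, ENNReal.ofReal_natCast, ENNReal.ofReal_one]
  simp only [hcongr]
  rw [← ENNReal.ofReal_zero]
  exact ENNReal.tendsto_ofReal hreal

/-! ## §5 Composition -/

/-- **The line closes the crux modulo its stubs**: `HydroLimitInBand` BY NAME — mean Grönwall (G over B1, P3, P4) ⇒ C⁺ ⇒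
Grönwall core (G3, landed) ⇒ guarded Yau target (S2, landed `relEntropyVanishingInBand_of_gronwallCoreInBand`) ⇒ crux (S1, landed
`hydroLimitInBand_of_relEntropyVanishingInBand`). -/
theorem HydroLimitInBand_of : ImplosionDichotomy.HydroLimitInBand :=
  Theorems.hydroLimitInBand_of_relEntropyVanishingInBand
    (Theorems.EntropyClockDock.relEntropyVanishingInBand_of_gronwallCoreInBand
      (gronwallCoreBody_of_core
        (stub_meanGronwall stub_continuousEntropyBalance stub_kineticOneBlockInMean
          stub_collisionalOneBlockInMean)))

/-- The same composition, typed as the LaxScheme route's copy of the (shared) crux decl (definitional unfolding). -/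
theorem HydroLimitInBand_proof : LaxScheme.HydroLimitInBand :=
  HydroLimitInBand_of

end Summit.AtomisticToContinuum.HydrodynamicLimit.Cruxes.HydroLimitInBand.MeanCurrentBalance

end
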